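import Mathlib.Algebra.MvPolynomial.SchwartzZippel
import Mathlib.Algebra.Order.BigOperators.Group.Finset
import Literature.Combinatorics.Enumerative.FisherYatesShuffle
import HarnessLib

/-!
# Randomised zero test of a restricted trilinear `0/1` form (Schwartz–Zippel with 4-bit values)

Topic `Computability/AlgebraicComplexity`. Seventh instalment of the proof of
`Literature.Computability.AlgebraicComplexity.pratt2024_thm_1_9` (K. Pratt, STOC 2024, Thm. 1.9
[Pratt2024SCC]), the identity-testing step of §2:

> "Set `X_a = 0` if `a ∉ 𝓕₁'` and let `X_a` be a uniformly random element of `Y` otherwise, and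
> similarly for the `Y` and `Z` variables. By what we just said this is always zero on "no"
> instances, and by the Schwartz–Zippel lemma this is nonzero with [constant] probability on
> "yes" instances."

in the flat form the verified program uses. For a support predicate `Good a b c` on `[M]³`
(in the application: blockwise disjoint AND all three sets present in the relabelled families) the
form is `trilinearForm M Good ξ η ζ = ∑_{a,b,c<M} [Good a b c] ξ a η b ζ c` (`ℤ`-valued); the
program draws every value as the low four bits of a random word (`Y = {0, …, 15}`, `|Y| = 16`,
so the Schwartz–Zippel failure probability of the degree-`3` form is `≤ 3/16`; Pratt takes
`|Y| = 4`).

* `trilinearPoly`, `eval_trilinearPoly`, `totalDegree_trilinearPoly_le`, `trilinearPoly_ne_zero`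
  — the form is the evaluation of an integer polynomial of total degree `≤ 3` in `3M` variables,
  non-zero as soon as one good triple exists (evaluate at its indicator);
* **`card_trilinearForm_eq_zero_mul_le`** — Schwartz–Zippel (Mathlib
  `MvPolynomial.schwartz_zippel_totalDegree`): over any finite value set `S ⊆ ℤ`, at most
  `3 |S|^{3M} / |S|` value vectors annihilate the form;
* **`card_words_trilinearForm_ne_zero`** — the machine form: among the vectors of `3M` words of
  `w ≥ 4` bits, read modulo `16`, at least `13/16` of all make the form non-zero
  (fibres of `c ↦ c mod 16` have `≥ (2^w/16)^{3M}` elements, `div_le_card_filter_mod_eq`).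

## References

* [Pratt2024SCC] K. Pratt, *A stronger connection between the asymptotic rank conjecture and the
  set cover conjecture*, Proc. 56th STOC (2024), arXiv:2311.02774 — §2 (proof of Thm. 1.9).
* J. T. Schwartz, *Fast probabilistic algorithms for verification of polynomial identities*,
  J. ACM 27 (1980) 701–717, Cor. 1 (through Mathlib).
-/

noncomputable section

namespace Literature.Computability.AlgebraicComplexity

open Finset MvPolynomial Fintype

open scoped BigOperators

section Form

variable (M : ℕ) (Good : ℕ → ℕ → ℕ → Prop) [∀ a b c, Decidable (Good a b c)]

/-- The restricted trilinear `0/1` form `∑_{a,b,c<M} [Good a b c] · ξ a · η b · ζ c`.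
[cite: Pratt2024SCC, §2 (proof of Thm. 1.9)] -/
def trilinearForm (ξ η ζ : ℕ → ℤ) : ℤ :=
  ∑ a ∈ range M, ∑ b ∈ range M, ∑ c ∈ range M, if Good a b c then ξ a * η b * ζ c else 0

/-- Without a good triple the form vanishes identically ("always zero on no instances").
[cite: Pratt2024SCC, §2 (proof of Thm. 1.9)] -/
theorem trilinearForm_eq_zero_of_forall_not (h : ∀ a b c, a < M → b < M → c < M → ¬ Good a b c)
    (ξ η ζ : ℕ → ℤ) : trilinearForm M Good ξ η ζ = 0 := by
  unfold trilinearForm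
  refine sum_eq_zero fun a ha => sum_eq_zero fun b hb => sum_eq_zero fun c hc => ?_
  rw [mem_range] at ha hb hc
  rw [if_neg (h a b c ha hb hc)]

/-- The variable of the value `ξ a` (`l = 0`), `η a` (`l = 1`), `ζ a` (`l = 2`) among `3M`
variables. [folklore] -/
def varIdx (l : Fin 3) (a : Fin M) : Fin (3 * M) := finProdFinEquiv (l, a)

/-- Distinct (leg, index) pairs are distinct variables. [folklore] -/
theorem varIdx_inj {l l' : Fin 3} {a a' : Fin M} : varIdx M l a = varIdx M l' a' ↔ l = l' ∧ a = a' := by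
  unfold varIdx
  rw [finProdFinEquiv.injective.eq_iff, Prod.mk.injEq]

/-- Reading the three value vectors off an assignment of the `3M` variables (zero beyond `M`).
[folklore] -/
def readVar (f : Fin (3 * M) → ℤ) (l : Fin 3) (a : ℕ) : ℤ :=
  if h : a < M then f (varIdx M l ⟨a, h⟩) else 0

/-- `readVar` on an index below `M`. [folklore] -/
theorem readVar_of_lt (f : Fin (3 * M) → ℤ) (l : Fin 3) (a : Fin M) :
    readVar M f l a = f (varIdx M l a) := by
  unfold readVar
  rw [dif_pos a.2]

/-- The form as a polynomial in the `3M` value variables. [cite: Pratt2024SCC, §2 (proof of Thm. 1.9)] -/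
def trilinearPoly : MvPolynomial (Fin (3 * M)) ℤ :=
  ∑ a : Fin M, ∑ b : Fin M, ∑ c : Fin M,
    if Good a b c then X (varIdx M 0 a) * X (varIdx M 1 b) * X (varIdx M 2 c) else 0

/-- Evaluating the polynomial gives the form of the read-off value vectors. [folklore] -/
theorem eval_trilinearPoly (f : Fin (3 * M) → ℤ) :
    eval f (trilinearPoly M Good) =
      trilinearForm M Good (readVar M f 0) (readVar M f 1) (readVar M f 2) := by
  unfold trilinearPoly trilinearForm
  rw [Finset.sum_range (fun a => ∑ b ∈ range M, ∑ c ∈ range M,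
    if Good a b c then readVar M f 0 a * readVar M f 1 b * readVar M f 2 c else 0)]
  simp only [map_sum]
  refine sum_congr rfl fun a _ => ?_
  rw [Finset.sum_range (fun b => ∑ c ∈ range M,
    if Good a b c then readVar M f 0 a * readVar M f 1 b * readVar M f 2 c else 0)]
  refine sum_congr rfl fun b _ => ?_
  rw [Finset.sum_range (fun c =>
    if Good a b c then readVar M f 0 a * readVar M f 1 b * readVar M f 2 c else 0)]
  refine sum_congr rfl fun c _ => ?_
  rw [readVar_of_lt, readVar_of_lt, readVar_of_lt]
  split_ifs
  · simp only [map_mul, eval_X]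
  · simp

/-- The polynomial has total degree at most `3`. [folklore] -/
theorem totalDegree_trilinearPoly_le : (trilinearPoly M Good).totalDegree ≤ 3 := by
  unfold trilinearPoly
  refine (totalDegree_finsetSum _ _).trans (Finset.sup_le fun a _ => ?_)
  refine (totalDegree_finsetSum _ _).trans (Finset.sup_le fun b _ => ?_)
  refine (totalDegree_finsetSum _ _).trans (Finset.sup_le fun c _ => ?_)
  split_ifs
  · calc (X (varIdx M 0 a) * X (varIdx M 1 b) * X (varIdx M 2 c) :
          MvPolynomial (Fin (3 * M)) ℤ).totalDegree
        ≤ (X (varIdx M 0 a) * X (varIdx M 1 b) : MvPolynomial (Fin (3 * M)) ℤ).totalDegree +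
            (X (varIdx M 2 c) : MvPolynomial (Fin (3 * M)) ℤ).totalDegree := totalDegree_mul _ _
      _ ≤ ((X (varIdx M 0 a) : MvPolynomial (Fin (3 * M)) ℤ).totalDegree +
            (X (varIdx M 1 b) : MvPolynomial (Fin (3 * M)) ℤ).totalDegree) +
            (X (varIdx M 2 c) : MvPolynomial (Fin (3 * M)) ℤ).totalDegree :=
          Nat.add_le_add_right (totalDegree_mul _ _) _
      _ = 3 := by simp only [totalDegree_X]
  · simp

/-- If some good triple exists the polynomial is non-zero: it evaluates to `1` at the indicator of
the triple's three variables. [folklore] -/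
theorem trilinearPoly_ne_zero {a₀ b₀ c₀ : ℕ} (ha : a₀ < M) (hb : b₀ < M) (hc : c₀ < M)
    (hg : Good a₀ b₀ c₀) : trilinearPoly M Good ≠ 0 := by
  classical
  intro h0
  -- the indicator assignment
  set f : Fin (3 * M) → ℤ := fun v =>
    if v = varIdx M 0 ⟨a₀, ha⟩ ∨ v = varIdx M 1 ⟨b₀, hb⟩ ∨ v = varIdx M 2 ⟨c₀, hc⟩ then 1 else 0
    with hf
  have hf0 : ∀ a : Fin M, f (varIdx M 0 a) = if (a : ℕ) = a₀ then 1 else 0 := by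
    intro a
    simp only [hf, varIdx_inj]
    simp [Fin.ext_iff]
  have hf1 : ∀ b : Fin M, f (varIdx M 1 b) = if (b : ℕ) = b₀ then 1 else 0 := by
    intro b
    simp only [hf, varIdx_inj]
    simp [Fin.ext_iff]
  have hf2 : ∀ c : Fin M, f (varIdx M 2 c) = if (c : ℕ) = c₀ then 1 else 0 := by
    intro c
    simp only [hf, varIdx_inj]
    simp [Fin.ext_iff]
  have hev := congrArg (eval f) h0
  rw [map_zero] at hev
  unfold trilinearPoly at hev
  simp only [map_sum] at hev
  rw [Finset.sum_eq_single (⟨a₀, ha⟩ : Fin M), Finset.sum_eq_single (⟨b₀, hb⟩ : Fin M),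
    Finset.sum_eq_single (⟨c₀, hc⟩ : Fin M)] at hev
  · simp only [hg, if_true, map_mul, eval_X, hf0, hf1, hf2, mul_one] at hev
    exact one_ne_zero hev
  · intro c _ hne
    have hne' : (c : ℕ) ≠ c₀ := fun e => hne (Fin.ext e)
    split_ifs <;> simp [hf2, hne']
  · simp
  · intro b _ hne
    have hne' : (b : ℕ) ≠ b₀ := fun e => hne (Fin.ext e)
    refine sum_eq_zero fun c _ => ?_
    split_ifs <;> simp [hf1, hne']
  · simp
  · intro a _ hne
    have hne' : (a : ℕ) ≠ a₀ := fun e => hne (Fin.ext e)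
    refine sum_eq_zero fun b _ => sum_eq_zero fun c _ => ?_
    split_ifs <;> simp [hf0, hne']
  · simp

/-- **Schwartz–Zippel for the restricted trilinear form.** If a good triple exists then, for any
finite set `S` of integer values, the assignments `f ∈ S^{3M}` on which the form vanishes are at
most a `3/|S|` fraction: `#{f | form = 0} · |S| ≤ 3 · |S|^{3M}`.
[cite: Pratt2024SCC, §2 (proof of Thm. 1.9)] -/
theorem card_trilinearForm_eq_zero_mul_le {a₀ b₀ c₀ : ℕ} (ha : a₀ < M) (hb : b₀ < M) (hc : c₀ < M)
    (hg : Good a₀ b₀ c₀) (S : Finset ℤ) :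
    #{f ∈ piFinset fun _ : Fin (3 * M) => S |
        trilinearForm M Good (readVar M f 0) (readVar M f 1) (readVar M f 2) = 0} * #S ≤
      3 * #S ^ (3 * M) := by
  classical
  rcases Nat.eq_zero_or_pos #S with hS | hS
  · rw [hS, mul_zero]; exact Nat.zero_le _
  have hp := trilinearPoly_ne_zero M Good ha hb hc hg
  have hsz := MvPolynomial.schwartz_zippel_totalDegree hp S
  have hdeg := totalDegree_trilinearPoly_le M Good
  have hset : (piFinset fun _ : Fin (3 * M) => S).filter
      (fun f => trilinearForm M Good (readVar M f 0) (readVar M f 1) (readVar M f 2) = 0) =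
      (piFinset fun _ : Fin (3 * M) => S).filter (fun f => eval f (trilinearPoly M Good) = 0) := by
    refine Finset.filter_congr fun f _ => ?_
    rw [eval_trilinearPoly]
  rw [hset]
  set Z := #((piFinset fun _ : Fin (3 * M) => S).filter fun f => eval f (trilinearPoly M Good) = 0)
  have hSpos : (0 : ℚ≥0) < #S := by exact_mod_cast hS
  have hSpow : (0 : ℚ≥0) < (#S : ℚ≥0) ^ (3 * M) := pow_pos hSpos _
  have h1 : (Z : ℚ≥0) / (#S : ℚ≥0) ^ (3 * M) ≤ (3 : ℚ≥0) / #S :=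
    hsz.trans (div_le_div_of_nonneg_right (by exact_mod_cast hdeg) hSpos.le)
  rw [div_le_div_iff₀ hSpow hSpos] at h1
  exact_mod_cast h1

end Form

/-! ## Values from random words -/

section Words

variable (M : ℕ) (Good : ℕ → ℕ → ℕ → Prop) [∀ a b c, Decidable (Good a b c)]

/-- The value assignment read off a vector of words: the low four bits (the word modulo `16`).
[folklore] -/
def wordValues {L K : ℕ} (c : Fin L → Fin K) : Fin L → ℤ := fun v => (((c v : ℕ) % 16 : ℕ) : ℤ)

/-- **The machine form of the zero test.** If a good triple exists and the words have `w ≥ 4`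
bits, then at least `13/16` of all vectors `c ∈ [2^w]^{3M}` of words make the form of the values
`c mod 16` non-zero: `13 · (2^w)^{3M} ≤ 16 · #{c | form ≠ 0}`.
[cite: Pratt2024SCC, §2 (proof of Thm. 1.9)] -/
theorem card_words_trilinearForm_ne_zero {a₀ b₀ c₀ : ℕ} (ha : a₀ < M) (hb : b₀ < M) (hc : c₀ < M)
    (hg : Good a₀ b₀ c₀) {w : ℕ} (hw : 4 ≤ w) :
    13 * (2 ^ w) ^ (3 * M) ≤ 16 * #{c : Fin (3 * M) → Fin (2 ^ w) |
      trilinearForm M Good (readVar M (wordValues c) 0) (readVar M (wordValues c) 1)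
        (readVar M (wordValues c) 2) ≠ 0} := by
  classical
  -- the value set `S = {0, …, 15} ⊆ ℤ`
  let S : Finset ℤ := (range 16).image fun n : ℕ => (n : ℤ)
  have hScard : #S = 16 := by
    rw [Finset.card_image_of_injective _ Nat.cast_injective, card_range]
  let form : (Fin (3 * M) → ℤ) → ℤ := fun f =>
    trilinearForm M Good (readVar M f 0) (readVar M f 1) (readVar M f 2)
  -- good value vectors: at least `13 · 16^{3M-1}` of `S^{3M}`
  let G : Finset (Fin (3 * M) → ℤ) := (piFinset fun _ : Fin (3 * M) => S).filter fun f => form f ≠ 0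
  have hZ := card_trilinearForm_eq_zero_mul_le M Good ha hb hc hg S
  rw [hScard] at hZ
  have hsplit := Finset.card_filter_add_card_filter_not
    (s := piFinset fun _ : Fin (3 * M) => S) (fun f => form f = 0)
  rw [card_piFinset, prod_const, card_univ, Fintype.card_fin, hScard] at hsplit
  have hG : 13 * 16 ^ (3 * M) ≤ 16 * #G := by
    have hM : 1 ≤ 3 * M := by omega
    have e16 : (16 : ℕ) ^ (3 * M) = 16 * 16 ^ (3 * M - 1) := by
      rw [← pow_succ']; congr 1; omega
    change #((piFinset fun _ : Fin (3 * M) => S).filter fun f => form f = 0) * 16 ≤ _ at hZ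
    change _ + #((piFinset fun _ : Fin (3 * M) => S).filter fun f => ¬ form f = 0) = _ at hsplit
    have : G = (piFinset fun _ : Fin (3 * M) => S).filter fun f => ¬ form f = 0 := rfl
    rw [← this] at hsplit
    omega
  -- fibres of `c ↦ values` over `G` have at least `(2^w/16)^{3M}` elements
  have h16 : (2 : ℕ) ^ w / 16 * 16 = 2 ^ w := by
    obtain ⟨e, rfl⟩ := Nat.exists_eq_add_of_le hw
    rw [pow_add, show (2 : ℕ) ^ 4 = 16 by norm_num, Nat.mul_div_cancel_left _ (by norm_num),
      Nat.mul_comm]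
  have hfib : ∀ g ∈ G, ((2 : ℕ) ^ w / 16) ^ (3 * M) ≤
      #{c : Fin (3 * M) → Fin (2 ^ w) | wordValues c = g} := by
    intro g hg'
    have hgS : ∀ v, g v ∈ S := fun v => mem_piFinset.1 (mem_filter.1 hg').1 v
    -- the box `∏_v {cv | cv % 16 = g v}` sits inside the fibre
    have hnat : ∀ v, ∃ t : ℕ, t < 16 ∧ g v = t := fun v => by
      obtain ⟨t, ht, e⟩ := mem_image.1 (hgS v)
      exact ⟨t, mem_range.1 ht, e.symm⟩
    choose t ht htg using hnat
    calc ((2 : ℕ) ^ w / 16) ^ (3 * M) = ∏ _v : Fin (3 * M), 2 ^ w / 16 := by simp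
      _ ≤ ∏ v : Fin (3 * M), #({cv : Fin (2 ^ w) | (cv : ℕ) % 16 = t v} : Finset _) :=
          prod_le_prod' fun v _ =>
            Literature.Combinatorics.Enumerative.div_le_card_filter_mod_eq (2 ^ w) 16 (t v) (ht v)
      _ = #(piFinset fun v : Fin (3 * M) => ({cv : Fin (2 ^ w) | (cv : ℕ) % 16 = t v} : Finset _)) :=
          (card_piFinset _).symm
      _ ≤ _ := card_le_card fun c hcv => ?_
    rw [mem_piFinset] at hcv
    simp only [mem_filter, mem_univ, true_and] at hcv ⊢
    funext v
    simp only [wordValues, hcv v, htg v]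
  -- sum over the fibres
  have hcount : #G * ((2 : ℕ) ^ w / 16) ^ (3 * M) ≤ #{c : Fin (3 * M) → Fin (2 ^ w) |
      form (wordValues c) ≠ 0} := by
    rw [card_eq_sum_card_fiberwise (f := fun c : Fin (3 * M) → Fin (2 ^ w) => wordValues c)
      (t := G) (fun c hcg => by
        have h' := (mem_filter.1 (Finset.mem_coe.1 hcg)).2
        exact Finset.mem_coe.2 (mem_filter.2 ⟨mem_piFinset.2 fun v => mem_image.2
          ⟨(c v : ℕ) % 16, mem_range.2 (Nat.mod_lt _ (by norm_num)), rfl⟩, h'⟩))]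
    calc #G * ((2 : ℕ) ^ w / 16) ^ (3 * M) = ∑ _g ∈ G, ((2 : ℕ) ^ w / 16) ^ (3 * M) := by
          rw [sum_const, smul_eq_mul]
      _ ≤ _ := sum_le_sum fun g hg' => (hfib g hg').trans (card_le_card fun c hcv => ?_)
    simp only [mem_filter, mem_univ, true_and] at hcv ⊢
    have hgG := (mem_filter.1 hg').2
    exact ⟨by rw [hcv]; exact hgG, hcv⟩
  -- arithmetic: `13 (2^w)^{3M} = 13 · 16^{3M} (2^w/16)^{3M} ≤ 16 #G (2^w/16)^{3M} ≤ 16 · #good`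
  have hpow : (2 ^ w) ^ (3 * M) = 16 ^ (3 * M) * ((2 : ℕ) ^ w / 16) ^ (3 * M) := by
    rw [← mul_pow, Nat.mul_comm 16 (2 ^ w / 16), h16]
  calc 13 * (2 ^ w) ^ (3 * M) = 13 * 16 ^ (3 * M) * ((2 : ℕ) ^ w / 16) ^ (3 * M) := by
        rw [hpow, mul_assoc]
    _ ≤ 16 * #G * ((2 : ℕ) ^ w / 16) ^ (3 * M) := Nat.mul_le_mul_right _ hG
    _ = 16 * (#G * ((2 : ℕ) ^ w / 16) ^ (3 * M)) := by ring
    _ ≤ _ := Nat.mul_le_mul_left _ hcount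

end Words

end Literature.Computability.AlgebraicComplexity
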